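import Literature.NumberTheory.ComplexMultiplication.CMOrderMaximalOrderQuotientDimension
import HarnessLib

/-!
# The number of generators of `𝒪_K` over a non-maximal order: `gens_S(𝒪_K) = max_𝔭 dim_{S/𝔭} 𝒪_K/𝔭𝒪_K`
# (MARSEGLIA 2024 COROLLARY 4.4, second equality) `= 1 + max_𝔭 type(S + 𝔭𝒪_K)` (PROPOSITION 4.5, «In particular»)

Family `hodge`, lane `lit-hodgefound` (Track 2 foundations library; seat p15, row g28-#8), topic
`Literature/NumberTheory/ComplexMultiplication`, namespace `Literature.NumberTheory.ComplexMultiplication.CMTypeLattice`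
(the order `S = endOrder (M_μ)`; its copy `M` of the maximal order, `↑M = range (algebraMap (𝓞 K) K)`; `gens_S(I)` is
`Submodule.spanFinrank ↑I` (`CMOrderIdealGeneratorsCount`, LEMMA 4.2); `𝒪_K/𝔭𝒪_K = ↥↑M ⧸ 𝔭 • ⊤`; «`S ≠ 𝒪_K`» is
`∃ a : 𝓞 K, (a : K) ∉ S`; the over-orders `T = S + 𝔭𝒪_K = endOrder (M_ν)` and their global type
`type(T) = ⨆ 𝔔, type_𝔔(T)` are those of `CMOrderMaximalOrderQuotientDimension` (hypothesis `hν`) and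
`CMOrderCohenMacaulayTypeGlobal`).  THEOREMS ONLY: no definition, no instance, no named fact (net Literature debt `0`).

SCOPE.  COROLLARY 4.4 reads `gens(S) = gens_S(𝒪_K) = max_𝔭 dim_{S/𝔭}(𝒪_K/𝔭𝒪_K)`; its FIRST equality is LEMMA 4.3
[Greither82] («among all fractional `S`-ideals, the one that requires the biggest number of generators is `𝒪_K`»),
which is NOT formalised here; this file proves the SECOND equality (LEMMA 4.2 for `I = 𝒪_K`) and, with
PROPOSITION 4.5, the Greither-free form `gens_S(𝒪_K) = 1 + max_𝔭 type(S + 𝔭𝒪_K)` of its «In particular» clause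
(printed with `gens(S)` on the left).  `gens_S(𝒪_K) ≤ gens(S)` is `CMOrderCohenMacaulayTypeGenerators.spanFinrank_coe_le_iSup`.

## Source, VERBATIM

S. Marseglia, *Cohen-Macaulay type of orders, generators and ideal classes*, J. Algebra 658 (2024) 247–276
[Marseglia2024CMType] (arXiv:2206.03758, held `paper:arxiv-2206.03758`), §4, chunk p0010:

> "It is known that, among all fractional `S`-ideals, the one that requires the biggest number of generators is `𝒪_K`.
> Lemma 4.3 ([Greither82]). Let `S` be an order. Then `gens(S) ≤ max{2, gens_S(𝒪_K)}`. The inequality is strict if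
> and only if `S = 𝒪_K` and `𝒪_K` is a product of PID, that is, `K` has class number one.
> Corollary 4.4. Let `S` be a non-maximal order. Then `gens(S) = gens_S(𝒪_K) = max{dim_{S/𝔭}(𝒪_K/𝔭𝒪_K) : 𝔭 prime
> of S}`.  Proof. Since `S ≠ 𝒪_K` then `gens_S(𝒪_K) ≥ 2`. The first equality follows from Lemma 4.3 and the second
> follows from Lemma 4.2. […]
> Proposition 4.5. Let `𝔭` be a prime of an order `S`. Then `dim_{S/𝔭} 𝒪_K/𝔭𝒪_K = 1` if `𝔭` is invertible,
> `1 + type(S + 𝔭𝒪_K)` otherwise. In particular, if `S` is not maximal then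
> `gens(S) = 1 + max{type(S + 𝔭𝒪_K) : 𝔭 a prime of S}`. […] The last statement is an immediate consequence of
> Corollary 4.4."

## What is formalised (the printed proof, step by step)

* §1 «Since `S ≠ 𝒪_K` then `gens_S(𝒪_K) ≥ 2`»: at a non-invertible prime `dim_{S/𝔭} 𝒪_K/𝔭𝒪_K ≥ 2` (LEMMA 2.14 (i),
  `finrank_quotient_smul_top_two_le_of_not_isUnit`); the dimensions `dim_{S/𝔭} 𝒪_K/𝔭𝒪_K` are bounded
  (`bddAbove_range_finrank_quotient_smul_top`) and their maximum is attained (`exists_finrank_quotient_smul_top_eq_iSup`);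
  **COROLLARY 4.4, second equality, `spanFinrank_coe_eq_iSup_finrank_quotient_smul_top`:
  `gens_S(𝒪_K) = max_𝔭 dim_{S/𝔭} 𝒪_K/𝔭𝒪_K` for `S ≠ 𝒪_K`** (LEMMA 4.2, equality case `m ≥ 2`,
  `EndOrder.spanFinrank_eq_of_forall_finrank_quotient_le`); `gens_S(𝒪_K) ≥ 2` and «`𝒪_K` is a non-principal
  `S`-ideal» (`two_le_spanFinrank_coe_of_exists_not_mem`, `not_isPrincipal_coe_of_exists_not_mem`); for `S = 𝒪_K`,
  `gens_S(𝒪_K) = 1` (`spanFinrank_coe_eq_one_of_forall_mem`).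
* §2 PROPOSITION 4.5 «In particular», Greither-free: for `S ≠ 𝒪_K`, every over-order `T = S + 𝔭𝒪_K` at a
  non-invertible prime has `type(T) + 1 ≤ gens_S(𝒪_K)` (`iSup_finrank_traceDual_quotient_add_one_le_spanFinrank_coe`),
  with equality at a prime maximising `dim 𝒪_K/𝔭𝒪_K` (`exists_not_isUnit_forall_iSup_add_one_eq_spanFinrank_coe`).
-/

noncomputable section

open scoped nonZeroDivisors NumberField
open NumberField Module FractionalIdeal
open Submodule (traceDual)

namespace Literature.NumberTheory.ComplexMultiplication

namespace CMTypeLattice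

variable {K : Type} [Field K] [NumberField K]
variable {ι : Type} [Fintype ι] [DecidableEq ι] (μ : Basis ι ℚ K) [Nonempty ι]
variable [IsFractionRing (endOrder (Algebra.leftMulMatrix μ)) K]

/-! ## §1 COROLLARY 4.4 (second equality): `gens_S(𝒪_K) = max_𝔭 dim_{S/𝔭} 𝒪_K/𝔭𝒪_K` for `S ≠ 𝒪_K` -/

omit [Nonempty ι] [IsFractionRing (endOrder (Algebra.leftMulMatrix μ)) K] in
/-- The maximal order `M` (`↑M = 𝒪_K`) is a nonzero fractional ideal. [cite: Marseglia2024CMType, §2.2, p. 5] -/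
theorem ne_zero_of_coe_eq_range {M : FractionalIdeal (endOrder (Algebra.leftMulMatrix μ))⁰ K}
    (hMO : (M : Set K) = (algebraMap (𝓞 K) K).range) : M ≠ 0 := by
  obtain ⟨-, h1⟩ := EndOrder.mul_self_le_and_one_mem_of_coe_eq_range hMO
  intro h
  rw [h] at h1
  exact one_ne_zero ((mem_zero_iff _).1 h1)

/-- **At a non-invertible prime, `dim_{S/𝔭} 𝒪_K/𝔭𝒪_K ≥ 2`** (LEMMA 2.14 (i): the dimension is `1` iff `𝔭` is
invertible, and it is always `≥ 1`). [cite: Marseglia2024CMType, §2.5 Lemma 2.14 (i), p. 7; §4 Cor. 4.4 (proof: «Since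
`S ≠ 𝒪_K` then `gens_S(𝒪_K) ≥ 2`»), p. 10] -/
theorem finrank_quotient_smul_top_two_le_of_not_isUnit {M : FractionalIdeal (endOrder (Algebra.leftMulMatrix μ))⁰ K}
    (hMO : (M : Set K) = (algebraMap (𝓞 K) K).range) {𝔭 : Ideal (endOrder (Algebra.leftMulMatrix μ))}
    [h𝔭 : 𝔭.IsPrime] (h0 : 𝔭 ≠ ⊥) (hu : ¬ IsUnit (𝔭 : FractionalIdeal (endOrder (Algebra.leftMulMatrix μ))⁰ K)) :
    2 ≤ Module.finrank (endOrder (Algebra.leftMulMatrix μ) ⧸ 𝔭)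
      (↥(M : Submodule (endOrder (Algebra.leftMulMatrix μ)) K) ⧸
        (𝔭 • ⊤ : Submodule (endOrder (Algebra.leftMulMatrix μ)) (M : Submodule (endOrder (Algebra.leftMulMatrix μ)) K))) := by
  haveI := isMaximal_of_isPrime_endOrder (Algebra.leftMulMatrix μ) h𝔭 h0
  haveI := isNoetherianRing_endOrder (Algebra.leftMulMatrix μ)
  have h1 : Module.finrank (endOrder (Algebra.leftMulMatrix μ) ⧸ 𝔭)
      (↥(M : Submodule (endOrder (Algebra.leftMulMatrix μ)) K) ⧸
        (𝔭 • ⊤ : Submodule (endOrder (Algebra.leftMulMatrix μ))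
          (M : Submodule (endOrder (Algebra.leftMulMatrix μ)) K))) ≠ 1 :=
    fun h ↦ hu ((EndOrder.finrank_quotient_eq_one_iff_isUnit_coeIdeal hMO h0).1 h)
  have hpos := NumberRing.finrank_quotient_smul_top_pos (K := K) 𝔭 (fg_of_isNoetherianRing le_rfl M)
    (fun h ↦ ne_zero_of_coe_eq_range μ hMO (coeToSubmodule_eq_bot.1 h))
  omega

/-- The dimensions `dim_{S/𝔭} 𝒪_K/𝔭𝒪_K` are bounded (by `[K:ℚ]`), so `max_𝔭` is a maximum.
[cite: Marseglia2024CMType, §4 Cor. 4.4, p. 10; §4 Lemma 4.2, p. 10] -/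
theorem bddAbove_range_finrank_quotient_smul_top {M : FractionalIdeal (endOrder (Algebra.leftMulMatrix μ))⁰ K}
    (hMO : (M : Set K) = (algebraMap (𝓞 K) K).range) :
    BddAbove (Set.range fun 𝔭 : MaximalSpectrum (endOrder (Algebra.leftMulMatrix μ)) ↦
      Module.finrank (endOrder (Algebra.leftMulMatrix μ) ⧸ 𝔭.asIdeal)
        (↥(M : Submodule (endOrder (Algebra.leftMulMatrix μ)) K) ⧸
          (𝔭.asIdeal • ⊤ : Submodule (endOrder (Algebra.leftMulMatrix μ))
            (M : Submodule (endOrder (Algebra.leftMulMatrix μ)) K)))) := by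
  refine ⟨Fintype.card ι, ?_⟩
  rintro _ ⟨𝔭, rfl⟩
  exact finrank_quotient_smul_top_le_card μ (ne_zero_of_coe_eq_range μ hMO) (asIdeal_ne_bot μ 𝔭)

/-- The maximum `max_𝔭 dim_{S/𝔭} 𝒪_K/𝔭𝒪_K` is attained at some prime. [cite: Marseglia2024CMType, §4 Cor. 4.4,
p. 10; §4 Lemma 4.2 (proof: «`𝒜 = {𝔭 : gens_{S_𝔭}(I_𝔭) = m}`»), p. 10] -/
theorem exists_finrank_quotient_smul_top_eq_iSup {M : FractionalIdeal (endOrder (Algebra.leftMulMatrix μ))⁰ K}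
    (hMO : (M : Set K) = (algebraMap (𝓞 K) K).range) :
    ∃ 𝔭 : MaximalSpectrum (endOrder (Algebra.leftMulMatrix μ)),
      Module.finrank (endOrder (Algebra.leftMulMatrix μ) ⧸ 𝔭.asIdeal)
        (↥(M : Submodule (endOrder (Algebra.leftMulMatrix μ)) K) ⧸
          (𝔭.asIdeal • ⊤ : Submodule (endOrder (Algebra.leftMulMatrix μ))
            (M : Submodule (endOrder (Algebra.leftMulMatrix μ)) K))) =
      ⨆ 𝔭 : MaximalSpectrum (endOrder (Algebra.leftMulMatrix μ)),
        Module.finrank (endOrder (Algebra.leftMulMatrix μ) ⧸ 𝔭.asIdeal)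
          (↥(M : Submodule (endOrder (Algebra.leftMulMatrix μ)) K) ⧸
            (𝔭.asIdeal • ⊤ : Submodule (endOrder (Algebra.leftMulMatrix μ))
              (M : Submodule (endOrder (Algebra.leftMulMatrix μ)) K))) := by
  haveI := nonempty_maximalSpectrum μ
  obtain ⟨𝔭, h𝔭⟩ := Nat.sSup_mem (Set.range_nonempty _) (bddAbove_range_finrank_quotient_smul_top μ hMO)
  exact ⟨𝔭, h𝔭⟩

/-- **MARSEGLIA 2024 COROLLARY 4.4, second equality: `gens_S(𝒪_K) = max_𝔭 dim_{S/𝔭} 𝒪_K/𝔭𝒪_K` for a non-maximal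
order `S`** («the second follows from Lemma 4.2»: at a non-invertible prime the dimension is `≥ 2`, so the
maximum `m` is `≥ 2` and LEMMA 4.2 gives `gens_S(𝒪_K) = m`). [cite: Marseglia2024CMType, §4 Cor. 4.4, p. 10; §4
Lemma 4.2, p. 10] -/
theorem spanFinrank_coe_eq_iSup_finrank_quotient_smul_top {M : FractionalIdeal (endOrder (Algebra.leftMulMatrix μ))⁰ K}
    (hMO : (M : Set K) = (algebraMap (𝓞 K) K).range)
    (hS : ∃ a : 𝓞 K, (a : K) ∉ endOrder (Algebra.leftMulMatrix μ)) :
    (M : Submodule (endOrder (Algebra.leftMulMatrix μ)) K).spanFinrank =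
      ⨆ 𝔭 : MaximalSpectrum (endOrder (Algebra.leftMulMatrix μ)),
        Module.finrank (endOrder (Algebra.leftMulMatrix μ) ⧸ 𝔭.asIdeal)
          (↥(M : Submodule (endOrder (Algebra.leftMulMatrix μ)) K) ⧸
            (𝔭.asIdeal • ⊤ : Submodule (endOrder (Algebra.leftMulMatrix μ))
              (M : Submodule (endOrder (Algebra.leftMulMatrix μ)) K))) := by
  obtain ⟨𝔭₀, h𝔭₀⟩ := (exists_not_isUnit_coeIdeal_iff μ).2 hS
  have hbdd := bddAbove_range_finrank_quotient_smul_top μ hMO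
  have h2 := (finrank_quotient_smul_top_two_le_of_not_isUnit μ hMO (asIdeal_ne_bot μ 𝔭₀) h𝔭₀).trans
    (le_ciSup hbdd 𝔭₀)
  exact EndOrder.spanFinrank_eq_of_forall_finrank_quotient_le (ne_zero_of_coe_eq_range μ hMO) h2
    (fun 𝔭 ↦ le_ciSup hbdd 𝔭) (exists_finrank_quotient_smul_top_eq_iSup μ hMO)

/-- **«Since `S ≠ 𝒪_K` then `gens_S(𝒪_K) ≥ 2`».** [cite: Marseglia2024CMType, §4 Cor. 4.4 (proof), p. 10] -/
theorem two_le_spanFinrank_coe_of_exists_not_mem {M : FractionalIdeal (endOrder (Algebra.leftMulMatrix μ))⁰ K}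
    (hMO : (M : Set K) = (algebraMap (𝓞 K) K).range)
    (hS : ∃ a : 𝓞 K, (a : K) ∉ endOrder (Algebra.leftMulMatrix μ)) :
    2 ≤ (M : Submodule (endOrder (Algebra.leftMulMatrix μ)) K).spanFinrank := by
  obtain ⟨𝔭₀, h𝔭₀⟩ := (exists_not_isUnit_coeIdeal_iff μ).2 hS
  rw [spanFinrank_coe_eq_iSup_finrank_quotient_smul_top μ hMO hS]
  exact (finrank_quotient_smul_top_two_le_of_not_isUnit μ hMO (asIdeal_ne_bot μ 𝔭₀) h𝔭₀).trans
    (le_ciSup (bddAbove_range_finrank_quotient_smul_top μ hMO) 𝔭₀)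

/-- **`𝒪_K` is not a principal `S`-module when `S ≠ 𝒪_K`** (it needs `≥ 2` generators). [cite: Marseglia2024CMType,
§4 Cor. 4.4 (proof), p. 10; §4 Lemma 4.2 («with equality if and only if […] `I` is not principal»), p. 10] -/
theorem not_isPrincipal_coe_of_exists_not_mem {M : FractionalIdeal (endOrder (Algebra.leftMulMatrix μ))⁰ K}
    (hMO : (M : Set K) = (algebraMap (𝓞 K) K).range)
    (hS : ∃ a : 𝓞 K, (a : K) ∉ endOrder (Algebra.leftMulMatrix μ)) :
    ¬ (M : Submodule (endOrder (Algebra.leftMulMatrix μ)) K).IsPrincipal := fun h ↦ by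
  have h1 := (Submodule.spanFinrank_eq_one_iff _).2
    ⟨h, fun hb ↦ ne_zero_of_coe_eq_range μ hMO (coeToSubmodule_eq_bot.1 hb)⟩
  have h2 := two_le_spanFinrank_coe_of_exists_not_mem μ hMO hS
  omega

omit [Nonempty ι] [IsFractionRing (endOrder (Algebra.leftMulMatrix μ)) K] in
/-- **For the maximal order itself, `gens_{𝒪_K}(𝒪_K) = 1`** (`𝒪_K = 1·S` is principal when `S = 𝒪_K`; the
hypothesis «non-maximal» of COROLLARY 4.4 at work). [cite: Marseglia2024CMType, §4 Lemma 4.3 («strict if and only if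
`S = 𝒪_K` and […]»), Cor. 4.4, p. 10] -/
theorem spanFinrank_coe_eq_one_of_forall_mem {M : FractionalIdeal (endOrder (Algebra.leftMulMatrix μ))⁰ K}
    (hMO : (M : Set K) = (algebraMap (𝓞 K) K).range)
    (hS : ∀ a : 𝓞 K, (a : K) ∈ endOrder (Algebra.leftMulMatrix μ)) :
    (M : Submodule (endOrder (Algebra.leftMulMatrix μ)) K).spanFinrank = 1 := by
  have hM1 : M = 1 := by
    obtain ⟨-, h1⟩ := EndOrder.mul_self_le_and_one_mem_of_coe_eq_range hMO
    refine le_antisymm (fun x hx ↦ ?_) (FractionalIdeal.one_le.2 h1)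
    have hx' : x ∈ (M : Set K) := hx
    rw [hMO] at hx'
    obtain ⟨y, rfl⟩ := hx'
    exact (mem_one_iff _).2 ⟨⟨y, hS y⟩, rfl⟩
  rw [hM1, FractionalIdeal.coe_one, Submodule.one_eq_span]
  exact Submodule.spanFinrank_singleton one_ne_zero

/-! ## §2 PROPOSITION 4.5 «In particular», without LEMMA 4.3: `gens_S(𝒪_K) = 1 + max_𝔭 type(S + 𝔭𝒪_K)` -/

/-- **`type(S + 𝔭𝒪_K) + 1 ≤ gens_S(𝒪_K)` at every non-invertible prime `𝔭` of a non-maximal `S`** — the over-order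
`T = S + 𝔭𝒪_K = endOrder (M_ν)` being given by `hν` as in `CMOrderMaximalOrderQuotientDimension` and `↑T′ = Tᵗ` its
trace dual (PROP. 4.5: `type(T) + 1 = dim_{S/𝔭} 𝒪_K/𝔭𝒪_K ≤ max = gens_S(𝒪_K)`). [cite: Marseglia2024CMType, §4 Prop. 4.5
(«In particular»), Cor. 4.4, p. 10] -/
theorem iSup_finrank_traceDual_quotient_add_one_le_spanFinrank_coe (ν : Basis ι ℚ K)
    {M : FractionalIdeal (endOrder (Algebra.leftMulMatrix μ))⁰ K}
    (hMO : (M : Set K) = (algebraMap (𝓞 K) K).range) {𝔭 : Ideal (endOrder (Algebra.leftMulMatrix μ))}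
    [h𝔭 : 𝔭.IsMaximal] (hu : ¬ IsUnit (𝔭 : FractionalIdeal (endOrder (Algebra.leftMulMatrix μ))⁰ K))
    (hν : ∀ x : K, x ∈ endOrder (Algebra.leftMulMatrix ν) ↔
      ∃ s ∈ endOrder (Algebra.leftMulMatrix μ),
        ∃ y ∈ (𝔭 : FractionalIdeal (endOrder (Algebra.leftMulMatrix μ))⁰ K) * M, x = s + y)
    {T' : FractionalIdeal (endOrder (Algebra.leftMulMatrix ν))⁰ K}
    (hT' : (T' : Submodule (endOrder (Algebra.leftMulMatrix ν)) K) =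
      traceDual ℤ ℚ ((1 : FractionalIdeal (endOrder (Algebra.leftMulMatrix ν))⁰ K) :
        Submodule (endOrder (Algebra.leftMulMatrix ν)) K)) :
    (⨆ 𝔔 : MaximalSpectrum (endOrder (Algebra.leftMulMatrix ν)),
        Module.finrank (endOrder (Algebra.leftMulMatrix ν) ⧸ 𝔔.asIdeal)
          ((T' : Submodule (endOrder (Algebra.leftMulMatrix ν)) K) ⧸
            (𝔔.asIdeal • ⊤ : Submodule (endOrder (Algebra.leftMulMatrix ν))
              (T' : Submodule (endOrder (Algebra.leftMulMatrix ν)) K)))) + 1 ≤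
      (M : Submodule (endOrder (Algebra.leftMulMatrix μ)) K).spanFinrank := by
  haveI := isFractionRing_endOrder (Algebra.leftMulMatrix ν)
  obtain ⟨𝔓, h𝔓⟩ := exists_ideal_mem_iff_coe_mem μ ν hMO hν
  have hS : ∃ a : 𝓞 K, (a : K) ∉ endOrder (Algebra.leftMulMatrix μ) :=
    (exists_not_isUnit_coeIdeal_iff μ).1 ⟨⟨𝔭, h𝔭⟩, hu⟩
  rw [spanFinrank_coe_eq_iSup_finrank_quotient_smul_top μ hMO hS,
    ← finrank_quotient_smul_top_eq_iSup_finrank_traceDual_quotient_add_one μ ν hMO hν h𝔓 hu hT']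
  exact le_ciSup (bddAbove_range_finrank_quotient_smul_top μ hMO) ⟨𝔭, h𝔭⟩

/-- **MARSEGLIA 2024 PROPOSITION 4.5, «In particular» (with `gens_S(𝒪_K)` for `gens(S)`, i.e. short of LEMMA 4.3):
for a non-maximal order `S` there is a non-invertible prime `𝔭` — any prime maximising `dim_{S/𝔭} 𝒪_K/𝔭𝒪_K` — with
`gens_S(𝒪_K) = 1 + type(S + 𝔭𝒪_K)`**, for every presentation `T = endOrder (M_ν)` of `S + 𝔭𝒪_K` and its trace dual.
[cite: Marseglia2024CMType, §4 Prop. 4.5 («In particular, if `S` is not maximal then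
`gens(S) = 1 + max{type(S + 𝔭𝒪_K) : 𝔭 a prime of S}`»), Cor. 4.4, p. 10] -/
theorem exists_not_isUnit_forall_iSup_add_one_eq_spanFinrank_coe
    {M : FractionalIdeal (endOrder (Algebra.leftMulMatrix μ))⁰ K}
    (hMO : (M : Set K) = (algebraMap (𝓞 K) K).range)
    (hS : ∃ a : 𝓞 K, (a : K) ∉ endOrder (Algebra.leftMulMatrix μ)) :
    ∃ 𝔭 : MaximalSpectrum (endOrder (Algebra.leftMulMatrix μ)),
      ¬ IsUnit (𝔭.asIdeal : FractionalIdeal (endOrder (Algebra.leftMulMatrix μ))⁰ K) ∧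
      ∀ ν : Basis ι ℚ K, (∀ x : K, x ∈ endOrder (Algebra.leftMulMatrix ν) ↔
          ∃ s ∈ endOrder (Algebra.leftMulMatrix μ),
            ∃ y ∈ (𝔭.asIdeal : FractionalIdeal (endOrder (Algebra.leftMulMatrix μ))⁰ K) * M, x = s + y) →
        ∀ T' : FractionalIdeal (endOrder (Algebra.leftMulMatrix ν))⁰ K,
          (T' : Submodule (endOrder (Algebra.leftMulMatrix ν)) K) =
            traceDual ℤ ℚ ((1 : FractionalIdeal (endOrder (Algebra.leftMulMatrix ν))⁰ K) :
              Submodule (endOrder (Algebra.leftMulMatrix ν)) K) →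
          (⨆ 𝔔 : MaximalSpectrum (endOrder (Algebra.leftMulMatrix ν)),
              Module.finrank (endOrder (Algebra.leftMulMatrix ν) ⧸ 𝔔.asIdeal)
                ((T' : Submodule (endOrder (Algebra.leftMulMatrix ν)) K) ⧸
                  (𝔔.asIdeal • ⊤ : Submodule (endOrder (Algebra.leftMulMatrix ν))
                    (T' : Submodule (endOrder (Algebra.leftMulMatrix ν)) K)))) + 1 =
            (M : Submodule (endOrder (Algebra.leftMulMatrix μ)) K).spanFinrank := by
  obtain ⟨𝔭, h𝔭⟩ := exists_finrank_quotient_smul_top_eq_iSup μ hMO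
  -- the maximising prime is not invertible: the maximum is `≥ 2`
  obtain ⟨𝔭₀, h𝔭₀⟩ := (exists_not_isUnit_coeIdeal_iff μ).2 hS
  have hbdd := bddAbove_range_finrank_quotient_smul_top μ hMO
  have h2 := (finrank_quotient_smul_top_two_le_of_not_isUnit μ hMO (asIdeal_ne_bot μ 𝔭₀) h𝔭₀).trans
    (le_ciSup hbdd 𝔭₀)
  rw [← h𝔭] at h2
  have hu : ¬ IsUnit (𝔭.asIdeal : FractionalIdeal (endOrder (Algebra.leftMulMatrix μ))⁰ K) := fun hu ↦ by
    have h1 := (EndOrder.finrank_quotient_eq_one_iff_isUnit_coeIdeal hMO (asIdeal_ne_bot μ 𝔭)).2 hu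
    omega
  refine ⟨𝔭, hu, fun ν hν T' hT' ↦ ?_⟩
  haveI := isFractionRing_endOrder (Algebra.leftMulMatrix ν)
  obtain ⟨𝔓, h𝔓⟩ := exists_ideal_mem_iff_coe_mem μ ν hMO hν
  rw [spanFinrank_coe_eq_iSup_finrank_quotient_smul_top μ hMO hS, ← h𝔭,
    finrank_quotient_smul_top_eq_iSup_finrank_traceDual_quotient_add_one μ ν hMO hν h𝔓 hu hT']

end CMTypeLattice

end Literature.NumberTheory.ComplexMultiplication
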